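import Literature.NumberTheory.EllipticCurves.ZpExtensionEisensteinDVRSettingH4AdjointProofs
import HarnessLib

/-!
# H.4 at the places `v ∈ S` for the curve's Eisenstein setting, IV: the MIRROR projection formula (Adj-mirror)
# (reduction on the `T`-side, division `×p^d` on the `Tw T`-side) — the (Adj) input of the FLIPPED descent

`Proofs` file (theorems only; no definition, no named fact, no instance, no `sorry`).  Sequel of
`ZpExtensionEisensteinDVRSettingH4AdjointProofs` ((Adj): division on the `T`-side, reduction on the `Tw T`-side).

The exact-annihilator clause of Howard's H.4 at a finite place `v` for `F_𝔮` (Def. 3.1.2) has two liftability inputs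
(Dual): `hDualY` (a class of `H¹(K_v, Tw T^{(k)})` orthogonal to the Kummer classes lifts to the limit) and its mirror
`hDualX` (the same with the roles of `T` and `Tw T` exchanged), each obtained from
`Tower.mem_levelCondition_top_of_forall_pairing_bot_eq_zero_of_range` — for `hDualX` applied to the FLIPPED system
`(Y, X, B.flip)`.  The (Adj) input of the flipped system reads, in the un-flipped pairing,

  (Adj-mirror) `incQ d (B k (red^{(d)} w) y) = B (k + d) w (up′ d y)`,

with `up′_d = H¹(K_v, Tw(×p^d) : Tw T^{(k)} ↪ Tw T^{(k+d)})` — the SAME division `F (k+1) (k+d+1)` of the curve's tower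
read on the conjugate-twisted modules (`DiscreteGaloisModule.restrictMap _ cd.conj`, `Tw T = T` restricted along
conjugation by `τ`) — and the same value maps `incQ_d = H²(K_v, ι_d(1))`, `ι_d ∘ reduce = p^d ·`.  This file proves it
for the curve's tower `W.eisensteinTower κ hm` and ANY H.4 data `D k` over `A_{m,k+1}` with the reduction identity
`he_red`, from x9-p1-w4's generic `DualityDatum.localCup_map_adjoint` at `u := red^{(d)}`, `r := F (k+1) (k+d+1)`,
`φ := ι_d`, whose pairing clause `ι_d (e_k(red^{(d)} s, t)) = e_{k+d}(s, F t)` is the iterated reduction identity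
`reduce_e_redIter` plus `F ∘ red^{(d)} = p^d ·` (`eisensteinTwistTorsionTransfer_redIter`) and bilinearity:

* §1 `eisensteinTower_localCup_adjoint_left` (one `ι_d`), §2 `eisensteinTower_localCup_towerAdjoint_left` (the binder
  shape with `Tower.redIter red k d w` on the `T`-side tower, a family `ι_d`) and
  `eisensteinTower_exists_incQ_localCup_towerAdjoint_left` (the value maps existentially).

Cell `pub/bsd-print-x9` (STUB A, `hfin4`, brick (M2) of the custodian's assembly split).  No summit statement is proved
here; BSD is not proved by any of this.  References: [Howard2004HeegnerKolyvagin] §1.1 Def. 1.1.3, §1.3 (Tw T) and H.4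
(arXiv:1202.6340 p. 7 L33–37, L78–82), §1.6 (p. 11 L33–38, p. 12 L29–33), Def. 3.1.2; [NeukirchSchmidtWingberg2008] I §4
(1.4.2)–(1.4.6); [SerreGaloisCohomology1997] I §2.2, §2.4.
-/

set_option autoImplicit false

noncomputable section

open Function NumberField IsDedekindDomain Field
open scoped NumberField ContRepresentation

namespace WeierstrassCurve

open Literature.NumberTheory.EllipticCurves Literature.NumberTheory.GaloisRepresentations
open Literature.NumberTheory.GaloisRepresentations.DiscreteGaloisModule
open Literature.NumberTheory.GaloisCohomology Literature.NumberTheory.GaloisCohomology.Howard2004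
open Literature.NumberTheory.EllipticCurves.ZpExtension (EisensteinLevel)

variable {K : Type} [Field K] [NumberField K] (W : WeierstrassCurve ℚ) [W.IsElliptic] {p : ℕ} [hp : Fact p.Prime]
  (κ : ZpExtension K p) {m : ℕ} (hm : 1 ≤ m) (cd : ConjugationDatum K)
  (D : letI := IwasawaAlgebra.isLocalRing_quotient_X_pow_add_C p hm
    ∀ k, DualityDatum p cd ((W.eisensteinTower κ hm).ρ k) (IwasawaAlgebra.EisensteinCoeff p m (k + 1)))

/-! ## §1 (Adj-mirror) for one value map -/

/-- **(Adj-mirror) `H²(ι_d(1)) (H¹(red^{(d)}) w ∪_k y) = w ∪_{k+d} H¹(Tw(×p^d)) y` at every place** — for H.4 data satisfying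
the reduction identity `he_red` of the setting and ANY value map `ι_d` with `ι_d ∘ reduce = p^d ·`:
`DualityDatum.localCup_map_adjoint` at `u := red^{(d)}` (left), `r := F (k+1) (k+d+1)` read on `Tw` (right), `φ := ι_d`;
its pairing clause `ι_d (e_k(red^{(d)} s, t)) = e_{k+d}(s, F t)` is `reduce_e_redIter`, `F ∘ red^{(d)} = p^d ·` and
bilinearity. [cite: Howard2004HeegnerKolyvagin, §1.3 (Tw T) and H.4 (arXiv p. 7, L33–37, L78–82), §1.6 (p. 11, L33–38)]
[cite: NeukirchSchmidtWingberg2008, I §4 (1.4.2)–(1.4.6)] -/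
theorem eisensteinTower_localCup_adjoint_left
    (he_red : letI := IwasawaAlgebra.isLocalRing_quotient_X_pow_add_C p hm
      ∀ k (x y : EisensteinLevel p m (fun j ↦ geomTorsion (W.baseChange K) ((p : ℤ) ^ j)) (k + 1 + 1)),
        IwasawaAlgebra.EisensteinCoeff.reduce p m (Nat.le_succ (k + 1)) ((D (k + 1)).e x y) =
          (D k).e ((W.eisensteinTower κ hm).red k x) ((W.eisensteinTower κ hm).red k y))
    (k d : ℕ) (v : Place K)
    (ι : IwasawaAlgebra.EisensteinCoeff p m (k + 1) →+ IwasawaAlgebra.EisensteinCoeff p m (k + d + 1))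
    (hι : ∀ x : IwasawaAlgebra.EisensteinCoeff p m (k + d + 1),
      ι (IwasawaAlgebra.EisensteinCoeff.reduce p m (Nat.succ_le_succ (Nat.le_add_right k d)) x) = p ^ d • x)
    (w : letI := IwasawaAlgebra.isLocalRing_quotient_X_pow_add_C p hm
      galoisCohomology (((W.eisensteinTower κ hm).ρ (k + d)).toLocal v) 1)
    (y : letI := IwasawaAlgebra.isLocalRing_quotient_X_pow_add_C p hm
      galoisCohomology ((cd.twist ((W.eisensteinTower κ hm).ρ k)).toLocal v) 1) :
    letI := IwasawaAlgebra.isLocalRing_quotient_X_pow_add_C p hm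
    ContinuousRep.cohomologyMap ((D k).twistOne.toLocal v) ((D (k + d)).twistOne.toLocal v) ι
        continuous_of_discreteTopology
        (fun _ z => (D k).twistOne_apply_of_apply_reduce (D (k + d)) _ ι (p ^ d) hι _ z) 2
        ((D k).localCup v
          (ContinuousRep.cohomologyMap (((W.eisensteinTower κ hm).ρ (k + d)).toLocal v)
            (((W.eisensteinTower κ hm).ρ k).toLocal v) ((W.eisensteinTower κ hm).redIter k d).toAddMonoidHom
            continuous_of_discreteTopology (fun _ z => (W.eisensteinTower κ hm).redIter_equivariant k d _ z) 1 w) y) =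
      (D (k + d)).localCup v w
        (galoisCohomology.map (DiscreteGaloisModule.localMap (DiscreteGaloisModule.restrictMap
          ((W.baseChange K).eisensteinTwistTorsionTransfer κ hm
            (fun j ↦ (W.baseChange K).torsionGaloisModuleReduce p j)
            (W.torsionGaloisModuleReduce_coe (K := K) (p := p)) (k + 1) (k + d + 1)) cd.conj) v) 1 y) := by
  letI := IwasawaAlgebra.isLocalRing_quotient_X_pow_add_C p hm
  let F := (W.baseChange K).eisensteinTwistTorsionTransfer κ hm
    (fun j ↦ (W.baseChange K).torsionGaloisModuleReduce p j) (W.torsionGaloisModuleReduce_coe (K := K) (p := p))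
  have he : ∀ (s : EisensteinLevel p m (fun j ↦ geomTorsion (W.baseChange K) ((p : ℤ) ^ j)) (k + d + 1))
      (t : EisensteinLevel p m (fun j ↦ geomTorsion (W.baseChange K) ((p : ℤ) ^ j)) (k + 1)),
      ι ((D k).e ((W.eisensteinTower κ hm).redIter k d s) t) =
        (D (k + d)).e s (F (k + 1) (k + d + 1)
          (t : IwasawaAlgebra.EisensteinCoeff.Twisted p m (k + 1) (geomTorsion (W.baseChange K) ((p : ℤ) ^ (k + 1))))) := by
    intro s t
    obtain ⟨t', rfl⟩ := (W.eisensteinTower κ hm).redIter_surjective k d t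
    have h1 := W.reduce_e_redIter κ hm cd D he_red k d s t'
    have h2 := W.eisensteinTwistTorsionTransfer_redIter κ hm k d t'
    rw [← h1, hι]
    change _ = (D (k + d)).e s (F (k + 1) (k + d + 1) _)
    rw [h2, LinearMap.map_smul_of_tower]
  exact (D k).localCup_map_adjoint (D (k + d)) ((W.eisensteinTower κ hm).redIter k d).toAddMonoidHom
    (fun g z => (W.eisensteinTower κ hm).redIter_equivariant k d g z)
    ((F (k + 1) (k + d + 1)).toContinuousLinearMap.toLinearMap.toAddMonoidHom)
    (fun g z => congrArg (fun φ ↦ φ z) ((F (k + 1) (k + d + 1)).isIntertwining' g)) ι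
    (fun g z => (D k).twistOne_apply_of_apply_reduce (D (k + d)) _ ι (p ^ d) hι g z) (fun s t => he s t) v w y

/-! ## §2 The package: `hAdj` of the flipped descent -/

/-- **The (Adj-mirror) level input of the FLIPPED H.4 descent for the curve's Eisenstein setting at a place `v`**: for the
`D`-indexed towers `X_j = H¹(K_v, T^{(j)})` (one-step maps `H¹(red_j)`), `Y_j = H¹(K_v, Tw T^{(j)})`, pairings
`B_j = (D j).localCup v`, the `Tw`-side level maps `up′ d := H¹(K_v, Tw(F (k+1) (k+d+1)))`
(`galoisCohomology.map (localMap (restrictMap _ cd.conj) v) 1`, the currency of the (Ker-Y) input) and the comparison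
maps `incQ d := H²(K_v, ι_d(1))` of ANY family of value maps `ι_d` with `ι_d ∘ reduce = p^d ·`:
`incQ d (B k (redIter red k d w) y) = B (k + d) w (up′ d y)` — i.e. LITERALLY the hypothesis `hAdj` of
`Tower.mem_levelCondition_top_of_forall_pairing_bot_eq_zero_of_range` for `(Y, X, fun j ↦ (B j).flip)`
(`AddMonoidHom.flip_apply` is `rfl`). [cite: Howard2004HeegnerKolyvagin, §1.3 (Tw T) and H.4 (arXiv p. 7, L33–37, L78–82), §1.6 (p. 11 L33–38, p. 12 L29–33), Def. 3.1.2]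
[cite: NeukirchSchmidtWingberg2008, I §4 (1.4.2)–(1.4.6)] -/
theorem eisensteinTower_localCup_towerAdjoint_left
    (he_red : letI := IwasawaAlgebra.isLocalRing_quotient_X_pow_add_C p hm
      ∀ k (x y : EisensteinLevel p m (fun j ↦ geomTorsion (W.baseChange K) ((p : ℤ) ^ j)) (k + 1 + 1)),
        IwasawaAlgebra.EisensteinCoeff.reduce p m (Nat.le_succ (k + 1)) ((D (k + 1)).e x y) =
          (D k).e ((W.eisensteinTower κ hm).red k x) ((W.eisensteinTower κ hm).red k y))
    (v : Place K) (k : ℕ)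
    (ι : ∀ d : ℕ, IwasawaAlgebra.EisensteinCoeff p m (k + 1) →+ IwasawaAlgebra.EisensteinCoeff p m (k + d + 1))
    (hι : ∀ (d : ℕ) (x : IwasawaAlgebra.EisensteinCoeff p m (k + d + 1)),
      ι d (IwasawaAlgebra.EisensteinCoeff.reduce p m (Nat.succ_le_succ (Nat.le_add_right k d)) x) = p ^ d • x) :
    letI := IwasawaAlgebra.isLocalRing_quotient_X_pow_add_C p hm
    ∀ (d : ℕ) (y : galoisCohomology ((cd.twist ((W.eisensteinTower κ hm).ρ k)).toLocal v) 1)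
      (w : galoisCohomology (((W.eisensteinTower κ hm).ρ (k + d)).toLocal v) 1),
      ContinuousRep.cohomologyMap ((D k).twistOne.toLocal v) ((D (k + d)).twistOne.toLocal v) (ι d)
          continuous_of_discreteTopology
          (fun _ z => (D k).twistOne_apply_of_apply_reduce (D (k + d)) _ (ι d) (p ^ d) (hι d) _ z) 2
          ((D k).localCup v
            (Tower.redIter (H := fun j ↦ galoisCohomology (((W.eisensteinTower κ hm).ρ j).toLocal v) 1)
              (fun j ↦ ContinuousRep.cohomologyMap (((W.eisensteinTower κ hm).ρ (j + 1)).toLocal v)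
                (((W.eisensteinTower κ hm).ρ j).toLocal v) ((W.eisensteinTower κ hm).red j).toAddMonoidHom
                continuous_of_discreteTopology (fun _ z => (W.eisensteinTower κ hm).red_equivariant j _ z) 1) k d w) y) =
        (D (k + d)).localCup v w
          (galoisCohomology.map (DiscreteGaloisModule.localMap (DiscreteGaloisModule.restrictMap
            ((W.baseChange K).eisensteinTwistTorsionTransfer κ hm
              (fun j ↦ (W.baseChange K).torsionGaloisModuleReduce p j)
              (W.torsionGaloisModuleReduce_coe (K := K) (p := p)) (k + 1) (k + d + 1)) cd.conj) v) 1 y) := by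
  letI := IwasawaAlgebra.isLocalRing_quotient_X_pow_add_C p hm
  intro d y w
  rw [(W.eisensteinTower κ hm).redIter_cohomologyMap_toLocal_eq v k d w]
  exact W.eisensteinTower_localCup_adjoint_left κ hm cd D he_red k d v (ι d) (hι d) w y

/-- **(Adj-mirror) with its value maps, existentially**: at every place `v` and base level `k` there are comparison maps
`incQ d : H²(K_v, A_{m,k+1}(1)) → H²(K_v, A_{m,k+d+1}(1))` with
`incQ d (B k (redIter red k d w) y) = B (k + d) w (up′ d y)`, `up′ d := H¹(K_v, Tw(F (k+1) (k+d+1)))` — the form consumed by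
the flipped `Tower.mem_levelCondition_top_of_forall_pairing_bot_eq_zero_of_range` (for `hDualX`).
[cite: Howard2004HeegnerKolyvagin, §1.3 H.4 (arXiv p. 7, L78–82) and §1.6 (p. 11 L33–38)]
[cite: NeukirchSchmidtWingberg2008, I §4 (1.4.2)–(1.4.6)] -/
theorem eisensteinTower_exists_incQ_localCup_towerAdjoint_left
    (he_red : letI := IwasawaAlgebra.isLocalRing_quotient_X_pow_add_C p hm
      ∀ k (x y : EisensteinLevel p m (fun j ↦ geomTorsion (W.baseChange K) ((p : ℤ) ^ j)) (k + 1 + 1)),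
        IwasawaAlgebra.EisensteinCoeff.reduce p m (Nat.le_succ (k + 1)) ((D (k + 1)).e x y) =
          (D k).e ((W.eisensteinTower κ hm).red k x) ((W.eisensteinTower κ hm).red k y))
    (v : Place K) (k : ℕ) :
    letI := IwasawaAlgebra.isLocalRing_quotient_X_pow_add_C p hm
    ∃ incQ : ∀ d : ℕ, galoisCohomology ((D k).twistOne.toLocal v) 2 →+
        galoisCohomology ((D (k + d)).twistOne.toLocal v) 2,
      ∀ (d : ℕ) (y : galoisCohomology ((cd.twist ((W.eisensteinTower κ hm).ρ k)).toLocal v) 1)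
        (w : galoisCohomology (((W.eisensteinTower κ hm).ρ (k + d)).toLocal v) 1),
        incQ d ((D k).localCup v
            (Tower.redIter (H := fun j ↦ galoisCohomology (((W.eisensteinTower κ hm).ρ j).toLocal v) 1)
              (fun j ↦ ContinuousRep.cohomologyMap (((W.eisensteinTower κ hm).ρ (j + 1)).toLocal v)
                (((W.eisensteinTower κ hm).ρ j).toLocal v) ((W.eisensteinTower κ hm).red j).toAddMonoidHom
                continuous_of_discreteTopology (fun _ z => (W.eisensteinTower κ hm).red_equivariant j _ z) 1) k d w) y) =
          (D (k + d)).localCup v w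
            (galoisCohomology.map (DiscreteGaloisModule.localMap (DiscreteGaloisModule.restrictMap
              ((W.baseChange K).eisensteinTwistTorsionTransfer κ hm
                (fun j ↦ (W.baseChange K).torsionGaloisModuleReduce p j)
                (W.torsionGaloisModuleReduce_coe (K := K) (p := p)) (k + 1) (k + d + 1)) cd.conj) v) 1 y) := by
  letI := IwasawaAlgebra.isLocalRing_quotient_X_pow_add_C p hm
  obtain ⟨ι, hι⟩ := IwasawaAlgebra.EisensteinCoeff.exists_forall_addMonoidHom_apply_reduce_eq_pow_smul (p := p) m k
  exact ⟨fun d ↦ ContinuousRep.cohomologyMap ((D k).twistOne.toLocal v) ((D (k + d)).twistOne.toLocal v) (ι d)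
      continuous_of_discreteTopology
      (fun _ z => (D k).twistOne_apply_of_apply_reduce (D (k + d)) _ (ι d) (p ^ d) (hι d) _ z) 2,
    W.eisensteinTower_localCup_towerAdjoint_left κ hm cd D he_red v k ι hι⟩

end WeierstrassCurve

end
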